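import Summits.CriticalPhenomena.PercolationContinuityZ3.Theorems.PercNearOneGluingNoHeavyLowerTailSahiCTCRtThreeWindowFourSum
import Summits.CriticalPhenomena.PercolationContinuityZ3.Theorems.PercNearOneGluingNoHeavyLowerTailSahiCTCRtThreeWindowFourPoly
import HarnessLib

/-!
# `NoHeavyLowerTail` (crux stmt-CriticalPhenomena-4575), P3 lane: the FOUR-POINT WINDOW CERTIFICATE of ROW 0 — the finite check and its soundness

Support file (seat `prim-l12-p3`, gen 51; `--supports stmt-CriticalPhenomena-4575`; `--computational`: ONE `native_decide`, the enumeration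
`checkAll = true` over the `114² = 12 996` pairs of loop-free up-sets on `Fin 4`, ≈ 10 s).  Memo
`run/shared/lean/prim/prim-l12/FROM-prim-l12-p3-g51-ROW0-ALL-K-LEAN.md`.

* coding: `testBit_encS(_val)`, `encS_injective`, `encS_insert`, `testBit_encF`, `bit_encF_encS`
  (bit `encS S` of `encF 𝒳` is `[S ∈ 𝒳]`);
* soundness of the coded moments: `momJc_encF`, `ιq_small{Xo,Zo,N,Y}_eq`, `momPc_encF`;
* the check and its unpacking: `checkPair_of_mem` (`checkAll = true` by `native_decide`, inside), `lin_nonneg_of_checkPair`, `lin_eq`, `mem_ups`, `coef_nonneg`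
  (for `𝒳, 𝒵 ∈ ups` all eight coefficients `Σ_c SJ c i · momJ c + Σ_m SP m i · momP m` are `≥ 0`);
* **`loc_nonneg_fin4`** : for `k ≥ 10` and loop-free up-sets `𝒳, 𝒵` on `Fin 4`, the local window atom sum at `k` points plus the localised small
  pairs is `≥ 0` (`…WindowFourSum.atomSum_local_eq/pairs_local_eq`, `…WindowFourPoly.loc_poly`, `Dfac > 0`, `j^i ≥ 0`).
No new definitions; nothing is asserted about the crux.
-/


namespace Summit.CriticalPhenomena.PercolationContinuityZ3.Theorems.SahiCTCForms

open Finset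

/-! ## Part CHECK: coding lemmas, the finite check, soundness, the local inequality on `Fin 4` -/

namespace RtThreeFin4

/-! ### Coding lemmas -/

/-- Bits of `encS`: bit `i` of `encS S` is set iff `i` is the value of a member of `S` (bits of a power sum, as in `…N2Five.testBit_sum_two_pow`).
[this work] -/
theorem testBit_encS (S : Finset (Fin 4)) (i : ℕ) : (encS S).testBit i ↔ i ∈ S.map Fin.valEmbedding := by
  have h : encS S = ∑ t ∈ S.map Fin.valEmbedding, 2 ^ t := by unfold encS; rw [sum_map]; rfl
  rw [h, ← Nat.mem_bitIndices, ← List.mem_toFinset, Finset.toFinset_bitIndices_sum_two_pow]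

/-- Bits of `encS` at the value of `i : Fin 4`: set iff `i ∈ S`. [this work] -/
theorem testBit_encS_val (S : Finset (Fin 4)) (i : Fin 4) : (encS S).testBit (i : ℕ) ↔ i ∈ S := by
  rw [testBit_encS, mem_map]
  exact ⟨fun ⟨a, ha, hai⟩ => (Fin.ext hai : a = i) ▸ ha, fun hi => ⟨i, hi, rfl⟩⟩

/-- `encS` is injective. [this work] -/
theorem encS_injective : Function.Injective encS := by
  intro S T h
  ext i
  rw [← testBit_encS_val, ← testBit_encS_val, h]

/-- `encS (insert u A) = 2^u + encS A` for `u ∉ A`. [this work] -/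
theorem encS_insert {A : Finset (Fin 4)} {u : Fin 4} (h : u ∉ A) : encS (insert u A) = 2 ^ (u : ℕ) + encS A := by
  unfold encS; rw [sum_insert h]

/-- Bits of `encF`: bit `c` of `encF F` is set iff `c` is the code of a member of `F`. [this work] -/
theorem testBit_encF (F : Finset (Finset (Fin 4))) (c : ℕ) : (encF F).testBit c ↔ ∃ S ∈ F, encS S = c := by
  unfold encF
  have h : ∑ S ∈ F, 2 ^ encS S = ∑ t ∈ F.image encS, 2 ^ t := (sum_image fun x _ y _ h => encS_injective h).symm
  rw [h, ← Nat.mem_bitIndices, ← List.mem_toFinset, Finset.toFinset_bitIndices_sum_two_pow, mem_image]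

/-- The bit indicator of a family code at a set code is the membership indicator. [this work] -/
theorem bit_encF_encS (F : Finset (Finset (Fin 4))) (S : Finset (Fin 4)) : ((bit (encF F) (encS S) : ℤ) : ℚ) = ιq F S := by
  unfold bit ιq
  have h : (encF F).testBit (encS S) = true ↔ S ∈ F := by
    rw [testBit_encF]
    exact ⟨fun ⟨T, hT, hTS⟩ => encS_injective hTS ▸ hT, fun hS => ⟨S, hS, rfl⟩⟩
  by_cases hS : S ∈ F
  · rw [if_pos (h.2 hS), if_pos hS]; norm_num
  · rw [if_neg (fun h' => hS (h.1 h')), if_neg hS]; norm_num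

/-! ### Soundness of the coded moments -/

/-- The coded `J`-moment of class `(n,s)` at the codes of `(𝒳, 𝒵)` is the `J`-moment. [this work] -/
theorem momJc_encF (n s : ℕ) (F G : Finset (Finset (Fin 4))) :
    ((momJc (atomsK n s) (encF F) (encF G) : ℤ) : ℚ) = momJ n s F G := by
  unfold momJc atomsK momJ
  rw [sum_image]
  · push_cast
    refine sum_congr rfl fun x hx => ?_
    obtain ⟨_, huA, huB⟩ := mem_filter.1 (mem_filter.1 hx).1
    rw [← encS_insert huA, ← encS_insert huB, bit_encF_encS, bit_encF_encS, bit_encF_encS, bit_encF_encS]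
  · intro x _ y _ h
    simp only [Prod.mk.injEq] at h
    exact Prod.ext (encS_injective h.1) (Prod.ext (Fin.ext h.2.1) (encS_injective h.2.2))

section SmallClasses
variable (F G : Finset (Finset (Fin 4))) (P : Finset (Fin 4))

/-- `[P ∈ X₂ᵒ] = [#P < 3]·[P ∈ 𝒳]·(1 − [P ∈ 𝒵])`. [this work] -/
theorem ιq_smallXo_eq : ιq (smallXo F G) P = (if #P < 3 then (1 : ℚ) else 0) * ιq F P * (1 - ιq G P) := by
  unfold ιq smallXo bySize
  simp only [mem_filter, mem_powerset, subset_univ, true_and]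
  by_cases h3 : #P < 3 <;> by_cases hF : P ∈ F <;> by_cases hG : P ∈ G <;> simp [h3, hF, hG]

/-- `[P ∈ Z₂ᵒ] = [#P < 3]·(1 − [P ∈ 𝒳])·[P ∈ 𝒵]`. [this work] -/
theorem ιq_smallZo_eq : ιq (smallZo F G) P = (if #P < 3 then (1 : ℚ) else 0) * (1 - ιq F P) * ιq G P := by
  unfold ιq smallZo bySize
  simp only [mem_filter, mem_powerset, subset_univ, true_and]
  by_cases h3 : #P < 3 <;> by_cases hF : P ∈ F <;> by_cases hG : P ∈ G <;> simp [h3, hF, hG]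

/-- `[P ∈ N₂] = [#P < 3]·(1 − [P ∈ 𝒳])·(1 − [P ∈ 𝒵])`. [this work] -/
theorem ιq_smallN_eq : ιq (smallN F G) P = (if #P < 3 then (1 : ℚ) else 0) * (1 - ιq F P) * (1 - ιq G P) := by
  unfold ιq smallN bySize
  simp only [mem_filter, mem_powerset, subset_univ, true_and]
  by_cases h3 : #P < 3 <;> by_cases hF : P ∈ F <;> by_cases hG : P ∈ G <;> simp [h3, hF, hG]

/-- `[P ∈ Y₂] = [#P < 3]·[P ∈ 𝒳]·[P ∈ 𝒵]`. [this work] -/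
theorem ιq_smallY_eq : ιq (smallY F G) P = (if #P < 3 then (1 : ℚ) else 0) * ιq F P * ιq G P := by
  unfold ιq smallY bySize
  simp only [mem_filter, mem_powerset, subset_univ, true_and]
  by_cases h3 : #P < 3 <;> by_cases hF : P ∈ F <;> by_cases hG : P ∈ G <;> simp [h3, hF, hG]

end SmallClasses

/-- The coded small-pair moment of class `m` at the codes of `(𝒳, 𝒵)` is the small-pair moment. [this work] -/
theorem momPc_encF (m : ℕ) (F G : Finset (Finset (Fin 4))) :
    ((momPc (pairsK m) (encF F) (encF G) : ℤ) : ℚ) = momP m F G := by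
  unfold momPc pairsK momP
  rw [sum_image]
  · push_cast
    refine sum_congr rfl fun x _ => ?_
    rw [bit_encF_encS, bit_encF_encS, bit_encF_encS, bit_encF_encS, ιq_smallXo_eq, ιq_smallZo_eq, ιq_smallN_eq, ιq_smallY_eq]
  · intro x _ y _ h
    simp only [Prod.mk.injEq] at h
    exact Prod.ext (encS_injective h.1) (encS_injective h.2.2.1)

/-! ### The finite check and its unpacking -/

/-- **THE FINITE CHECK** `checkAll = true` (`114² = 12 996` pairs of loop-free up-sets on `Fin 4`, eight coefficients each; ONE `native_decide`,
seconds), unpacked for a pair of members of `ups`. [this work] -/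
theorem checkPair_of_mem {F G : Finset (Finset (Fin 4))} (hF : F ∈ ups) (hG : G ∈ ups) :
    checkPair (JCLl.map fun c => atomsK c.1 c.2) ((List.range 5).map fun m => pairsK m) (encF F) (encF G) = true := by
  have h : checkAll = true := by native_decide
  unfold checkAll at h
  simp only [decide_eq_true_eq] at h
  exact h _ (mem_image_of_mem _ hF) _ (mem_image_of_mem _ hG)

/-- Unpacking `checkPair`: the eight linear forms are `≥ 0`. [this work] -/
theorem lin_nonneg_of_checkPair {tJ : List (Finset (ℕ × ℕ × ℕ))} {tP : List (Finset (ℕ × ℤ × ℕ × ℤ))} {f g : ℕ}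
    (h : checkPair tJ tP f g = true) (i : ℕ) (hi : i < 8) :
    0 ≤ lin i (tJ.map fun t => momJc t f g) (tP.map fun t => momPc t f g) := by
  unfold checkPair at h
  simp only [List.all_eq_true, List.mem_range, decide_eq_true_eq] at h
  exact h i hi

/-- `zipWith` against a mapped copy of the same list. [folklore] -/
theorem zipWith_map_self {β γ δ : Type*} (f : β → γ → δ) (h : β → γ) (l : List β) :
    List.zipWith f l (l.map h) = l.map fun c => f c (h c) := by
  induction l with
  | nil => rfl
  | cons a l ih => simp [ih]

/-- The linear form `lin i` on the coded moment vectors, as the Finset sums of the polynomial layer. [this work] -/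
theorem lin_eq (i f g : ℕ) :
    ((lin i ((JCLl.map fun c => atomsK c.1 c.2).map fun t => momJc t f g) (((List.range 5).map fun m => pairsK m).map fun t => momPc t f g)
        : ℤ) : ℚ) =
      ∑ c ∈ JCLl.toFinset, ((SJ c.1 c.2 i : ℤ) : ℚ) * momJc (atomsK c.1 c.2) f g
        + ∑ m ∈ range 5, ((SP m i : ℤ) : ℚ) * momPc (pairsK m) f g := by
  unfold lin
  rw [List.map_map, List.map_map, zipWith_map_self, zipWith_map_self, ← List.sum_toFinset _ (by decide : JCLl.Nodup),
    ← List.sum_toFinset _ (List.nodup_range), List.toFinset_range]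
  push_cast
  rfl

/-! ### Loop-free up-sets, the local inequality -/

/-- A family of sets with `≥ 2` points closed upward is a member of `ups`. [this work] -/
theorem mem_ups {F : Finset (Finset (Fin 4))} (h2 : ∀ S ∈ F, 2 ≤ #S) (hup : ∀ S ∈ F, ∀ T : Finset (Fin 4), S ⊆ T → T ∈ F) : F ∈ ups := by
  unfold ups bigSets
  refine mem_filter.2 ⟨mem_powerset.2 fun S hS => mem_filter.2 ⟨mem_powerset.2 (subset_univ _), h2 S hS⟩, fun S hS T _ hST => hup S hS T hST⟩

/-- The eight coefficients are `≥ 0` for a pair of loop-free up-sets. [this work] -/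
theorem coef_nonneg {F G : Finset (Finset (Fin 4))} (hF : F ∈ ups) (hG : G ∈ ups) (i : ℕ) (hi : i < 8) :
    0 ≤ ∑ c ∈ JCLl.toFinset, ((SJ c.1 c.2 i : ℤ) : ℚ) * momJ c.1 c.2 F G + ∑ m ∈ range 5, ((SP m i : ℤ) : ℚ) * momP m F G := by
  have h := lin_nonneg_of_checkPair (checkPair_of_mem hF hG) i hi
  have h' : (0 : ℚ) ≤ ((lin i ((JCLl.map fun c => atomsK c.1 c.2).map fun t => momJc t (encF F) (encF G))
      (((List.range 5).map fun m => pairsK m).map fun t => momPc t (encF F) (encF G)) : ℤ) : ℚ) := by exact_mod_cast h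
  rw [lin_eq] at h'
  simp only [momJc_encF, momPc_encF] at h'
  exact h'

/-- **THE LOCAL INEQUALITY ON `Fin 4`** (the hypothesis of `…LocalWindow.coeff_ind_Rt_three_nonneg_of_local` transported to `Fin 4`): for `k ≥ 10`
and every pair of loop-free up-sets on `Fin 4`, the local window atom sum at `k` points plus the localised small pairs is `≥ 0`. [this work] -/
theorem loc_nonneg_fin4 (k : ℕ) (hk : 10 ≤ k) (F G : Finset (Finset (Fin 4))) (hF : F ∈ ups) (hG : G ∈ ups) :
    0 ≤ atomSum
        (fun a b c => (if 5 ≤ a + b + c then 0 else ∑ t ∈ range 3, (((k - a - b - c).choose t : ℕ) : ℚ) *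
          (if b + c < k - t then ((((k - t : ℕ) : ℚ)) * ((((k - t - 1).choose (b + c) : ℕ) : ℚ)))⁻¹ else 0))
          / (((k - (a + b + c)).choose (4 - (a + b + c)) : ℕ) : ℚ))
        (fun a b c => (0 : ℚ) / (((k - (a + b + c)).choose (4 - (a + b + c)) : ℕ) : ℚ))
        (fun a b c => (0 : ℚ) / (((k - (a + b + c)).choose (4 - (a + b + c)) : ℕ) : ℚ))
        (fun a b c => (0 : ℚ) / (((k - (a + b + c)).choose (4 - (a + b + c)) : ℕ) : ℚ))
        (fun a b c => (0 : ℚ) / (((k - (a + b + c)).choose (4 - (a + b + c)) : ℕ) : ℚ)) F G univ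
      + ∑ P ∈ (univ : Finset (Fin 4)).powerset, ∑ P' ∈ (univ : Finset (Fin 4)).powerset,
        (ιq (smallXo F G) P * ιq (smallZo F G) P' * (if Disjoint P P' then 1 else 0) / (((k - #(P ∪ P')).choose (4 - #(P ∪ P')) : ℕ) : ℚ)
          - ιq (smallN F G) P * ιq (smallY F G) P' * (if Disjoint P P' then 1 else 0) / (((k - #(P ∪ P')).choose (4 - #(P ∪ P')) : ℕ) : ℚ)) := by
  obtain ⟨j, rfl⟩ : ∃ j, k = j + 10 := ⟨k - 10, by omega⟩
  rw [atomSum_local_eq, pairs_local_eq]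
  have hD : 0 < Dfac j := by unfold Dfac; positivity
  refine (mul_nonneg_iff_of_pos_left hD).1 ?_
  rw [loc_poly]
  exact sum_nonneg fun i hi => mul_nonneg (coef_nonneg hF hG i (mem_range.1 hi)) (by positivity)

end RtThreeFin4

end Summit.CriticalPhenomena.PercolationContinuityZ3.Theorems.SahiCTCForms
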